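import Literature.NumberTheory.DiophantineGeometry.FunctionFieldDivisors
import Literature.NumberTheory.DiophantineGeometry.FunctionFieldDivisorsConstantsProofs
import Literature.NumberTheory.DiophantineGeometry.FunctionFieldDivisorsOrdProofs
import HarnessLib

/-!
# Places of `F/K`: the triangle inequality for `ord_v` — discharged fact

Proof of the named fact `Literature.NumberTheory.DiophantineGeometry.AlgFunctionField.PlaceOver.min_ord_le_ord_add` stated in
`Literature.NumberTheory.DiophantineGeometry.FunctionFieldDivisors` (kept in a sibling file so
that the statement file stays a definitions/named-facts file; the unfolding lemma
`PlaceOver.ord_of_mem` is reused from `FunctionFieldDivisorsConstantsProofs` and the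
multiplicativity `PlaceOver.ord_mul_holds` from `FunctionFieldDivisorsOrdProofs`):

* `Literature.AlgFunctionField.PlaceOver.min_ord_le_ord_add_holds : min_ord_le_ord_add`, i.e. for every
  place `v` of `F/K` and all `x, y ∈ F` with `x, y, x + y ≠ 0`,
  `min (ord_v x) (ord_v y) ≤ ord_v (x + y)`.

## Source and proof architecture

H. Stichtenoth, *Algebraic Function Fields and Codes*, 2nd ed., GTM 254 (2009), §1.1:

* Def. 1.1.9 (p. 4): a *discrete valuation* of `F/K` is a map `v : F → ℤ ∪ {∞}` with
  (1) `v(x) = ∞ ↔ x = 0`, (2) `v(xy) = v(x) + v(y)`, (3) `v(x + y) ≥ min {v(x), v(y)}` (the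
  *Triangle Inequality*), (4) `∃ z, v(z) = 1`, (5) `v(a) = 0` for `0 ≠ a ∈ K`.
* Def. 1.1.12 (p. 5): `v_P(z) := n` where `z = tⁿ u`, `t` a prime element of `P`, `u ∈ O_P^×`.
* Thm. 1.1.13 (a) (pp. 5–6): `v_P` is a discrete valuation of `F/K`, and
  `O_P = {z ∈ F | v_P(z) ≥ 0}`. The printed proof of (3): let `v_P(x) = n ≤ m = v_P(y)`,
  `x = tⁿ u₁`, `y = tᵐ u₂`; then `x + y = tⁿ (u₁ + t^{m-n} u₂) = tⁿ z` with `z ∈ O_P`, so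
  `v_P(x + y) = n + v_P(z) ≥ n`.

(The docstring of the fact quotes the first-edition numbering "I.1.11 (3)"; in the 2009 edition
the same item is Def. 1.1.9 (3) with Def. 1.1.12 / Thm. 1.1.13 (a). The vendored statement is the
printed inequality restricted to `x, y, x + y ≠ 0`, where `PlaceOver.ord` agrees with `v_P`; it is
faithful.)

In Lean the same architecture reads: w.l.o.g. `y x⁻¹ ∈ O_v` (a valuation ring contains `y x⁻¹`
or its inverse `x y⁻¹`; this is the reduction "`n ≤ m`", Stichtenoth's `t^{m-n} u₂ u₁⁻¹ ∈ O_P`),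
and then `(x + y) x⁻¹ = 1 + y x⁻¹ ∈ O_v` (the element "`u₁⁻¹ z`"), so `ord_v x ≤ ord_v (x + y)`
by the monotonicity lemma `ord_le_ord_of_mul_inv_mem` (`z x⁻¹ ∈ O_v → ord_v x ≤ ord_v z`), which
is exactly the printed step "`v_P(tⁿ z) = n + v_P(z) ≥ n`": multiplicativity (2)
(`ord_mul_holds`) plus `v_P ≥ 0` on `O_P` (`ord_nonneg_of_mem`, immediate from the definition of
`PlaceOver.ord`).

## References

* H. Stichtenoth, *Algebraic Function Fields and Codes*, 2nd ed., GTM 254, Springer 2009, §1.1: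
  Def. 1.1.9 (3), Def. 1.1.12, Thm. 1.1.13 (a) (pp. 4–6).
-/

noncomputable section

namespace Literature.NumberTheory.DiophantineGeometry.AlgFunctionField.PlaceOver

universe u v

variable {K : Type u} {F : Type v} [Field K] [Field F] [Algebra K F]

/-- Elements of the valuation ring have nonnegative order: `O_P ⊆ {z ∈ F | v_P(z) ≥ 0}`
(Stichtenoth Thm. 1.1.13 (a); here immediate from the definition of `PlaceOver.ord`, whose value
on `O_v` is the natural number `addVal x`). [cite: Stichtenoth2009, Thm. 1.1.13(a)] -/
theorem ord_nonneg_of_mem (v : PlaceOver K F) {x : F} (hx : x ∈ v.toValuationSubring) :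
    0 ≤ v.ord x := by
  rw [ord_of_mem v hx]
  exact Int.natCast_nonneg _

/-- Monotonicity of `ord_v` along the valuation ring: if `z x⁻¹ ∈ O_v` (`x, z ≠ 0`) then
`ord_v x ≤ ord_v z`. This is Stichtenoth's step "`v_P(tⁿ z) = n + v_P(z) ≥ n` for `z ∈ O_P`" in
the proof of Thm. 1.1.13 (a): `ord_v z = ord_v (z x⁻¹) + ord_v x` by multiplicativity
(`ord_mul_holds`, Def. 1.1.9 (2)) and `ord_v (z x⁻¹) ≥ 0` (`ord_nonneg_of_mem`).
[cite: Stichtenoth2009, Thm. 1.1.13(a)] -/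
theorem ord_le_ord_of_mul_inv_mem (v : PlaceOver K F) {x z : F} (hx : x ≠ 0) (hz : z ≠ 0)
    (h : z * x⁻¹ ∈ v.toValuationSubring) : v.ord x ≤ v.ord z := by
  have hzx : z = z * x⁻¹ * x := by rw [inv_mul_cancel_right₀ hx]
  have h0 : z * x⁻¹ ≠ 0 := mul_ne_zero hz (inv_ne_zero hx)
  have hnonneg := ord_nonneg_of_mem v h
  rw [hzx, ord_mul_holds v h0 hx]
  omega

/-- **Discharge of `PlaceOver.min_ord_le_ord_add`**: the Triangle Inequality
`v_P(x + y) ≥ min {v_P(x), v_P(y)}` for the normalised order `ord_v` of a place, for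
`x, y, x + y ≠ 0` (Stichtenoth Def. 1.1.9 (3), established for `v_P` in Thm. 1.1.13 (a);
first-edition numbering I.1.11 (3) as quoted in the fact's docstring). Proof as printed: w.l.o.g.
`y x⁻¹ ∈ O_v` (else `x y⁻¹ = (y x⁻¹)⁻¹ ∈ O_v` and swap the roles of `x` and `y`), then
`(x + y) x⁻¹ = 1 + y x⁻¹ ∈ O_v`, so `ord_v x ≤ ord_v (x + y)` by `ord_le_ord_of_mul_inv_mem`.
[cite: Stichtenoth2009, §1.1: Def. 1.1.9(3), Def. 1.1.12, Thm. 1.1.13(a)] -/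
theorem min_ord_le_ord_add_holds : min_ord_le_ord_add (K := K) (F := F) := by
  intro v x y hx hy hxy
  rcases v.toValuationSubring.mem_or_inv_mem (y * x⁻¹) with h | h
  · have h' : (x + y) * x⁻¹ ∈ v.toValuationSubring := by
      rw [add_mul, mul_inv_cancel₀ hx]
      exact add_mem (one_mem _) h
    exact (min_le_left _ _).trans (ord_le_ord_of_mul_inv_mem v hx hxy h')
  · rw [mul_inv_rev, inv_inv] at h
    have h' : (x + y) * y⁻¹ ∈ v.toValuationSubring := by
      rw [add_mul, mul_inv_cancel₀ hy]
      exact add_mem h (one_mem _)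
    exact (min_le_right _ _).trans (ord_le_ord_of_mul_inv_mem v hy hxy h')

end Literature.NumberTheory.DiophantineGeometry.AlgFunctionField.PlaceOver
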